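import Literature.MathematicalPhysics.QuantumFieldTheory.Balaban1983to89.B6Eq2143TwoScaleV1

/-!
# `Balaban1983to89.B6Eq235TwoScaleV1` — T. Bałaban, *Propagators and renormalization transformations for lattice gauge theories. II*,
# Commun. Math. Phys. **96** (1984) 223–250 [Balaban1984PropagatorsII], p. 228 **(2.35)** *«A = HB = GQ*(QGQ*)⁻¹B»* and p. 249 (2.150):
# THE OPERATOR `H` OF THE GENUINE TWO-SCALE DATA `tsV1` (`G = Δ_a⁻¹` of (2.90), `Q = Q″Q_j`, `Λ′ ⊂ T^{(j+1)}` arbitrary) — `H = GQ*(QGQ*)⁻¹`,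
# `QH = I`, `Δ_aH = Q*(QGQ*)⁻¹` — AND ITS IDENTIFICATION WITH p21's OPERATORS OF RECORD: along the reindexing `𝔅 = Λ^c ⊔ Λ′ ≃ BondIdx` of the
# two-level family `…B6SectCTwoScaleV1.twoScale j hj Λ′`, `Q`, `Q*`, `QGQ*`, `(QGQ*)⁻¹` and `H` of `tsV1` ARE `QE`, `QsE`, `qgqE`, `EE` and
# `hOp (GE) (QsE) (EE)` of `…B6SectAVectorModelV1` / `…B6SectA` (printed weights)

statement-level skeleton of published theorems with citation tags; proofs where landed; nothing here is a claim about the Yang–Mills mass gap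

PRINT (verbatim).  p. 228: *"The operator G is positive, hence QGQ* is positive also and an inverse is a well-defined and positive operator.
We get ω = (QGQ*)⁻¹B, and from (2.22) we obtain finally A = HB = GQ*(QGQ*)⁻¹B. (2.35)"*; p. 249: *"At first let us consider the operator H.
We have Corollary 2.8. A kernel of the operator H, (HB)(b) = Σ_{c∈𝔅}(L^{j(c)}η)^dH(b, c)B(c), (2.150) satisfies …"*; p. 239: *"R, Δ_a as in
(2.17), (2.19), but only two scales are present now"*.

CITATION HEADER (lean-in-tree rule) — WHAT IS REPRODUCED.  Phase-2 file of the `lit-balaban` typed skeleton (HOME `run/shared/lean/pub/lit-balaban/`),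
seat **p22 gen 17** (B6 fold owner r03, referee ref-4; lane = Sect. C on the concrete two-scale data `tsV1`).  SKELETON rows **B6.Eq2.35** / **B6.Cor2.8**
(the operator `H`; this file is the DEFINITION-LEVEL BRIDGE for the two-scale instance of Cor. 2.8, `…B6Cor28TwoScaleV1`).  IMPORTS BY NAME, nothing
restated: gen 8's `…B6Eq2143TwoScaleV1.QGQs`/`isUnit_QGQs_V1` (`QGQ*` a unit), `…B6Eq2129TwoScaleV1.toBondIdx`/`toBondIdx_bijective`/`QE_toBondIdx`/
`wLevel`/`wLevel_pos`/`G_eq_GE`/`deltaA_comp_G_V1` (the Sect. A ↔ Sect. C bridge at the printed weights), p21's `…B6SectAOperatorsV1.QE`/`QsE`,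
`…B6SectAVectorModelV1.GE`/`qgqE`/`EE`/`EE_comp`/`qgqE_injective`, `…B6SectA.hOp` ((2.35) abstractly), Mathlib's `LinearIsometryEquiv.piLpCongrLeft`.

THIS FILE.
* §1 **`Hts`** `:= G ∘ Q* ∘ (QGQ*)⁻¹ : L²(𝔅) → (fine bond fields)` (an `abbrev`; `(QGQ*)⁻¹ = Ring.inverse QGQs`), **`Q_comp_Hts`** / `Q_Hts_apply` (`QH = I`),
  **`deltaA_comp_Hts`** (`Δ_aH = Q*(QGQ*)⁻¹`: `HB` solves (2.21)₁ with `λ = 0`, `ω = (QGQ*)⁻¹B`), `adjoint_Q_eq` (`Q* = Q_j*Q″*`);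
* §2 the reindexing **`reindex`** `: L²(𝔅) ≃ₗᵢ L²(BondIdx (twoScale j hj Λ′))` (Mathlib's `piLpCongrLeft` along gen 8's bijection `toBondIdx`),
  `reindex_apply`, `reindex_symm_apply`, `reindex_symm_single`, **`QE_eq`** (`QE = reindex ∘ Q`), **`QsE_eq`** (`QsE = Q* ∘ reindex⁻¹`);
* §3 at the printed weights `a` (`Λ^c`), `aL^{d−2}` (`Λ′`), `a > 0`: **`qgqE_eq`** (`qgqE = reindex ∘ QGQ* ∘ reindex⁻¹`), **`EE_eq`**
  (`EE = reindex ∘ (QGQ*)⁻¹ ∘ reindex⁻¹`), **`hOp_eq`** (`hOp GE QsE EE = H ∘ reindex⁻¹`), `hOp_reindex_apply` (`hOp (reindex B) = HB`),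
  `hOp_single_apply` (the entries of the `H` of record ARE the entries of `Hts`).
TWO `abbrev`s (`Hts`, `reindex`: data), THEOREMS otherwise; no `def … : Prop` fact; standard axioms.  HONEST SCOPE: finite V1 model; §3 at the PRINTED
two-level weights only (gen 8's `G_eq_GE`); the bounds of Cor. 2.8 are the business of `…B6Cor28TwoScaleV1`.  NOT summit progress.
Unit `lit-balaban-p22` (gen 17), 2026-08-22.
-/

noncomputable section

open scoped InnerProductSpace

namespace Literature.MathematicalPhysics.QuantumFieldTheory.Balaban1983to89.B6Eq235TwoScaleV1

open LatticeFieldCalculus B6SectADomainsV1 B6SectAOperatorsV1 B6SectAVectorModelV1 B6SectCTwoScaleV1 B6SectCTwoScaleV1Lattice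
  B6Eq2129TwoScaleV1
open B6SectCOperators (TwoScaleData)
open B6SectA (hOp)
open B6Eq2143TwoScaleV1 (QGQs isUnit_QGQs_V1)
open BalabanImbrieJaffe1984to88.BIJ85AxialPropagator411 (BondSpace)

variable {P : Params} {c : ℝ} (hc : c ≠ 0) {j : ℕ} (hj : j + 1 ≤ P.m + P.K) (Λ' : Finset (Site P (j + 1)))
  {w : CIdx j Λ' → ℝ} (hw : ∀ i, 0 < w i)

/-! ## §1  `H = GQ*(QGQ*)⁻¹`, `QH = I`, `Δ_aH = Q*(QGQ*)⁻¹` -/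

/-- **the operator `H = GQ*(QGQ*)⁻¹` of (2.35)/(2.150) for the two-scale data `tsV1`** (`G = Δ_a⁻¹` (2.90), `Q = Q″Q_j`, `(QGQ*)⁻¹` the one-box
covariance of (2.143)). [cite: Balaban1984PropagatorsII, (2.35) p.228, (2.150) p.249] -/
abbrev Hts : CSpace j Λ' →ₗ[ℝ] BondSpace P :=
  (tsV1 hc Λ' w).G ∘ₗ LinearMap.adjoint (tsV1 hc Λ' w).Q ∘ₗ Ring.inverse (QGQs hc Λ' (w := w))

include hj hw in
/-- **`QH = I`** (`QGQ*·(QGQ*)⁻¹ = 1`). [cite: Balaban1984PropagatorsII, (2.21) + (2.35) pp.226–228] -/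
theorem Q_comp_Hts : (tsV1 hc Λ' w).Q ∘ₗ Hts hc Λ' (w := w) = LinearMap.id := by
  have h := Ring.mul_inverse_cancel _ (isUnit_QGQs_V1 hc hj Λ' hw)
  rw [Module.End.mul_eq_comp, Module.End.one_eq_id] at h
  simpa only [QGQs, LinearMap.comp_assoc] using h

include hj hw in
/-- `QHB = B`. [cite: Balaban1984PropagatorsII, (2.21) + (2.35) pp.226–228] -/
theorem Q_Hts_apply (B : CSpace j Λ') : (tsV1 hc Λ' w).Q (Hts hc Λ' (w := w) B) = B := by
  have h := congrArg (fun f : CSpace j Λ' →ₗ[ℝ] CSpace j Λ' => f B) (Q_comp_Hts hc hj Λ' hw)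
  simpa only [LinearMap.comp_apply, LinearMap.id_apply] using h

include hj hw in
/-- **`Δ_aH = Q*(QGQ*)⁻¹`**: `A = HB` solves the first critical-point equation (2.21) `Δ_aA − ∂Rλ − Q*ω = 0` with `λ = 0`, `ω = (QGQ*)⁻¹B`.
[cite: Balaban1984PropagatorsII, (2.21)–(2.22) p.226, (2.35) p.228] -/
theorem deltaA_comp_Hts :
    (tsV1 hc Λ' w).deltaA ∘ₗ Hts hc Λ' (w := w) = LinearMap.adjoint (tsV1 hc Λ' w).Q ∘ₗ Ring.inverse (QGQs hc Λ' (w := w)) := by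
  rw [Hts, ← LinearMap.comp_assoc, deltaA_comp_G_V1 hc hj Λ' hw, LinearMap.id_comp]

/-- `Q* = Q_j*Q″*`. [cite: Balaban1984PropagatorsII, (2.144) p.248] -/
theorem adjoint_Q_eq : LinearMap.adjoint (tsV1 hc Λ' w).Q = LinearMap.adjoint (tsV1 hc Λ' w).Qv ∘ₗ LinearMap.adjoint (Qpp P j Λ') := by
  show LinearMap.adjoint ((tsV1 hc Λ' w).Qpp ∘ₗ (tsV1 hc Λ' w).Qv) = _
  exact LinearMap.adjoint_comp _ _

/-! ## §2  The reindexing `𝔅 = Λ^c ⊔ Λ′ ≃ BondIdx (twoScale j hj Λ′)` as a linear isometry of the `ℓ²` spaces; `Q`, `Q*` of record -/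

/-- **the reindexing isometry `L²(𝔅) ≃ L²(BondIdx)`** along gen 8's bijection `toBondIdx` (levels `j`, `j + 1` of the two-level family).
[cite: Balaban1984PropagatorsII, (2.3) p.224, (2.97) p.240] -/
abbrev reindex : CSpace j Λ' ≃ₗᵢ[ℝ] BondIdxSpace (twoScale j hj Λ') :=
  LinearIsometryEquiv.piLpCongrLeft 2 ℝ ℝ (Equiv.ofBijective (toBondIdx hj Λ') (toBondIdx_bijective hj Λ'))

/-- `(reindex B)(ι i) = B(i)`. [cite: Balaban1984PropagatorsII, (2.97) p.240] -/
theorem reindex_apply (B : CSpace j Λ') (i : CIdx j Λ') : reindex hj Λ' B (toBondIdx hj Λ' i) = B i := by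
  rw [LinearIsometryEquiv.piLpCongrLeft_apply, Equiv.piCongrLeft'_apply]
  exact congrArg B ((Equiv.ofBijective (toBondIdx hj Λ') (toBondIdx_bijective hj Λ')).symm_apply_apply i)

/-- `(reindex⁻¹ ω)(i) = ω(ι i)`. [cite: Balaban1984PropagatorsII, (2.97) p.240] -/
theorem reindex_symm_apply (ω : BondIdxSpace (twoScale j hj Λ')) (i : CIdx j Λ') :
    (reindex hj Λ').symm ω i = ω (toBondIdx hj Λ' i) := by
  rw [LinearIsometryEquiv.piLpCongrLeft_symm, LinearIsometryEquiv.piLpCongrLeft_apply, Equiv.piCongrLeft'_apply, Equiv.symm_symm]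
  rfl

/-- `reindex⁻¹ e_p = e_{ι⁻¹p}`. [cite: Balaban1984PropagatorsII, (2.97) p.240] -/
theorem reindex_symm_single [DecidableEq (CIdx j Λ')] [DecidableEq (BondIdx (twoScale j hj Λ'))] (p : BondIdx (twoScale j hj Λ')) :
    (reindex hj Λ').symm (EuclideanSpace.single p (1 : ℝ)) =
      EuclideanSpace.single ((Equiv.ofBijective (toBondIdx hj Λ') (toBondIdx_bijective hj Λ')).symm p) (1 : ℝ) := by
  rw [LinearIsometryEquiv.piLpCongrLeft_symm]
  convert EuclideanSpace.piLpCongrLeft_single (Equiv.ofBijective (toBondIdx hj Λ') (toBondIdx_bijective hj Λ')).symm p (1 : ℝ)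

/-- **`Q` of record is `Q = Q″Q_j` reindexed**: `QE (twoScale j hj Λ′) = reindex ∘ Q`. [cite: Balaban1984PropagatorsII, (2.6) p.224, (2.119) p.243] -/
theorem QE_eq : QE (twoScale j hj Λ') = (reindex hj Λ').toLinearMap ∘ₗ (tsV1 hc Λ' w).Q := by
  refine LinearMap.ext fun v => PiLp.ext fun p => ?_
  obtain ⟨i, rfl⟩ := (toBondIdx_bijective hj Λ').2 p
  rw [QE_toBondIdx, LinearMap.comp_apply]
  exact (reindex_apply hj Λ' ((tsV1 hc Λ' w).Q v) i).symm

/-- the adjoint of the reindexing isometry is its inverse. [cite: Balaban1984PropagatorsI, (1.21) p.21 (ℓ² adjoint; ours)] -/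
theorem adjoint_reindex : LinearMap.adjoint (reindex hj Λ').toLinearMap = (reindex hj Λ').symm.toLinearMap :=
  LinearIsometryEquiv.adjoint_toLinearMap_eq_symm _

/-- **`Q*` of record is `Q*` composed with the inverse reindexing**: `QsE (twoScale j hj Λ′) = Q* ∘ reindex⁻¹`.
[cite: Balaban1984PropagatorsII, (2.21) p.226 (`Q*`), (2.144) p.248] -/
theorem QsE_eq : QsE (twoScale j hj Λ') = LinearMap.adjoint (tsV1 hc Λ' w).Q ∘ₗ (reindex hj Λ').symm.toLinearMap := by
  rw [QsE, QE_eq hc hj Λ' (w := w), LinearMap.adjoint_comp, adjoint_reindex]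

/-! ## §3  At the printed weights: `QGQ*`, `(QGQ*)⁻¹` and `H` of record ARE the two-scale operators, reindexed -/

section Printed

variable {a : ℝ} (ha : 0 < a)

include hj ha in
/-- **`QGQ*` of record = `reindex ∘ QGQ* ∘ reindex⁻¹`** (gen 8's `G = GE` at the printed weights, §2). [cite: Balaban1984PropagatorsII, (2.35) p.228, (2.144) p.248] -/
theorem qgqE_eq : qgqE (twoScale j hj Λ') hc (w := wLevel P j a) (wLevel_pos (j := j) ha) =
    (reindex hj Λ').toLinearMap ∘ₗ QGQs hc Λ' (w := wPrinted P j Λ' a) ∘ₗ (reindex hj Λ').symm.toLinearMap := by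
  rw [qgqE_def, QE_eq hc hj Λ' (w := wPrinted P j Λ' a), QsE_eq hc hj Λ' (w := wPrinted P j Λ' a), ← G_eq_GE hc hj Λ' ha]
  simp only [QGQs, LinearMap.comp_assoc]

include hj ha in
/-- **`(QGQ*)⁻¹` of record = `reindex ∘ (QGQ*)⁻¹ ∘ reindex⁻¹`** (both are left inverses of the bijection `qgqE`). [cite: Balaban1984PropagatorsII, (2.35) p.228, (2.143) p.248] -/
theorem EE_eq : EE (twoScale j hj Λ') hc (w := wLevel P j a) (wLevel_pos (j := j) ha) =
    (reindex hj Λ').toLinearMap ∘ₗ Ring.inverse (QGQs hc Λ' (w := wPrinted P j Λ' a)) ∘ₗ (reindex hj Λ').symm.toLinearMap := by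
  have hw' : ∀ i, 0 < wPrinted P j Λ' a i := wPrinted_pos j Λ' ha
  have hsurj : Function.Surjective (qgqE (twoScale j hj Λ') hc (w := wLevel P j a) (wLevel_pos (j := j) ha)) :=
    LinearMap.injective_iff_surjective.mp (qgqE_injective _ hc _)
  refine (LinearMap.cancel_right hsurj).mp ?_
  have h1 : EE (twoScale j hj Λ') hc (w := wLevel P j a) (wLevel_pos (j := j) ha) ∘ₗ
      qgqE (twoScale j hj Λ') hc (w := wLevel P j a) (wLevel_pos (j := j) ha) = LinearMap.id := EE_comp _ hc _
  have h2 := Ring.inverse_mul_cancel _ (isUnit_QGQs_V1 hc hj Λ' hw')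
  rw [Module.End.mul_eq_comp, Module.End.one_eq_id] at h2
  rw [h1, qgqE_eq hc hj Λ' ha]
  have h2' : ∀ y : CSpace j Λ', Ring.inverse (QGQs hc Λ' (w := wPrinted P j Λ' a))
      ((tsV1 hc Λ' (wPrinted P j Λ' a)).Q ((tsV1 hc Λ' (wPrinted P j Λ' a)).G
        (LinearMap.adjoint (tsV1 hc Λ' (wPrinted P j Λ' a)).Q y))) = y := fun y => LinearMap.congr_fun h2 y
  refine LinearMap.ext fun ω => ?_
  simp only [LinearMap.comp_apply, LinearMap.id_apply, LinearEquiv.coe_coe, LinearIsometryEquiv.coe_toLinearEquiv,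
    LinearIsometryEquiv.symm_apply_apply, h2', LinearIsometryEquiv.apply_symm_apply]

include hj ha in
/-- **THE `H` OF RECORD IS `Hts`, REINDEXED**: `hOp (GE) (QsE) (EE) = H ∘ reindex⁻¹` for the two-level family at the printed weights — p21's (2.35)
`H = GQ*(QGQ*)⁻¹` built from `GE = Δ_a⁻¹`, `QsE = Q*`, `EE = (QGQ*)⁻¹`. [cite: Balaban1984PropagatorsII, (2.35) p.228, (2.150) p.249] -/
theorem hOp_eq : hOp (GE (twoScale j hj Λ') hc (w := wLevel P j a) (wLevel_pos (j := j) ha)) (QsE (twoScale j hj Λ'))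
      (EE (twoScale j hj Λ') hc (w := wLevel P j a) (wLevel_pos (j := j) ha)) =
    Hts hc Λ' (w := wPrinted P j Λ' a) ∘ₗ (reindex hj Λ').symm.toLinearMap := by
  rw [hOp, ← G_eq_GE hc hj Λ' ha, QsE_eq hc hj Λ' (w := wPrinted P j Λ' a), EE_eq hc hj Λ' ha]
  refine LinearMap.ext fun ω => ?_
  simp only [LinearMap.comp_apply, LinearEquiv.coe_coe, LinearIsometryEquiv.coe_toLinearEquiv, LinearIsometryEquiv.symm_apply_apply]

include hj ha in
/-- `hOp (reindex B) = HB`. [cite: Balaban1984PropagatorsII, (2.35) p.228, (2.150) p.249] -/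
theorem hOp_reindex_apply (B : CSpace j Λ') :
    hOp (GE (twoScale j hj Λ') hc (w := wLevel P j a) (wLevel_pos (j := j) ha)) (QsE (twoScale j hj Λ'))
      (EE (twoScale j hj Λ') hc (w := wLevel P j a) (wLevel_pos (j := j) ha)) (reindex hj Λ' B) =
    Hts hc Λ' (w := wPrinted P j Λ' a) B := by
  rw [hOp_eq hc hj Λ' ha, LinearMap.comp_apply]
  exact congrArg (Hts hc Λ' (w := wPrinted P j Λ' a)) ((reindex hj Λ').symm_apply_apply B)

include hj ha in
/-- **the entries of the `H` of record are the entries of `Hts`**: `hOp(e_p)(b₀) = H(e_{ι⁻¹p})(b₀)`. [cite: Balaban1984PropagatorsII, (2.150) p.249] -/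
theorem hOp_single_apply [DecidableEq (CIdx j Λ')] [DecidableEq (BondIdx (twoScale j hj Λ'))] (p : BondIdx (twoScale j hj Λ'))
    (b₀ : PBond P 0) :
    hOp (GE (twoScale j hj Λ') hc (w := wLevel P j a) (wLevel_pos (j := j) ha)) (QsE (twoScale j hj Λ'))
      (EE (twoScale j hj Λ') hc (w := wLevel P j a) (wLevel_pos (j := j) ha)) (EuclideanSpace.single p (1 : ℝ)) b₀ =
    Hts hc Λ' (w := wPrinted P j Λ' a)
      (EuclideanSpace.single ((Equiv.ofBijective (toBondIdx hj Λ') (toBondIdx_bijective hj Λ')).symm p) (1 : ℝ)) b₀ := by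
  rw [hOp_eq hc hj Λ' ha, LinearMap.comp_apply]
  exact congrArg (fun v => Hts hc Λ' (w := wPrinted P j Λ' a) v b₀) (reindex_symm_single hj Λ' p)

end Printed

end Literature.MathematicalPhysics.QuantumFieldTheory.Balaban1983to89.B6Eq235TwoScaleV1

end
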